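import Literature.Probability.Process.ItoIntegralCovariationRefined
import HarnessLib

/-!
# Covariation of Itô integrals against two integrators: the conditional (polarised) isometry

Third file of three.  For a raw filtration `𝓕` on a probability space `(Ω, μ)`, two continuous
square-integrable `𝓕`-martingales `B, B'` with `B_t² - t`, `B'_t² - t` martingales (Brownian
motions in Lévy's form) and **covariation `c t`** (`B_t B'_t - c t` a martingale; `c = 1` for
`B' = B`, `c = 0` for orthogonal, e.g. independent, Brownian motions), progressive integrands
`H, K` with `E ∫₀ᵗ H² < ∞`, `E ∫₀ᵗ K² < ∞`, and their Itô integrals `J = ∫ H dB`, `J' = ∫ K dB'`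
in the sense of the tree's characterised `Literature.Probability.Process.IsItoIntegral`:

  `E[Z (J_t - J_s)(J'_t - J'_s)] = c · E[Z ∫_{(s,t]} H_r K_r dr]`     (`s ≤ t`, `Z` bounded
  `𝓕_s`-measurable)

(`IsItoIntegral.integral_mul_sub_mul_sub`), i.e. `⟨J, J'⟩_t = c ∫₀ᵗ H K dr` in the weak sense:
the conditional Itô isometry for `B' = B`, and for `c = 0` the **orthogonality of Itô integrals
against orthogonal Brownian motions** — the zero cross-variation of different coordinates that
the product rule / Itô formula for SDE systems driven by a multidimensional Brownian motion needs
(e.g. the lattice Langevin dynamics of `Literature.MathematicalPhysics.QuantumFieldTheory`).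

Proof: the identity for the elementary integrals of the approximating simple sequences of the
construction (`exists_isItoIntegral_of_sqErr_ne_top`, with `L²(dr ⊗ μ)` approximation and `L²`
convergence at fixed times; part II `SimpleProcess.integral_mul_sub_mul_sub`), identification of
the given integrals with the constructed ones (uniqueness `IsItoIntegral.unique_holds`), and
passage to the limit: products of `L²`-convergent increments converge in `L¹(μ)`, and the time
integrals `∫_{(s,t]} Hₙ Kₙ dr → ∫_{(s,t]} H K dr` in `L¹(μ)` by Cauchy–Schwarz in `L²(dr ⊗ μ)`.

## References

* D. Revuz, M. Yor, *Continuous Martingales and Brownian Motion* (3rd ed., 1999), Ch. IV,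
  Thm (2.2) (`⟨K·M, N⟩ = K·⟨M, N⟩` characterises `K·M`; isometry `‖K·M‖_{H²} = ‖K‖_{L²(M)}`).
* J.-F. Le Gall, *Brownian Motion, Martingales, and Stochastic Calculus* (2016), Thm 5.4,
  eq. (5.6).
-/

open MeasureTheory ProbabilityTheory Filter Finset
open scoped NNReal ENNReal Topology

noncomputable section

namespace Literature.Probability.Process

variable {Ω : Type*} {m : MeasurableSpace Ω} {𝓕 : Filtration ℝ≥0 m} {μ : Measure Ω}

/-! ### The covariation of two Itô integrals -/

section Ito

variable {B B' : ℝ≥0 → Ω → ℝ} {c : ℝ} {H K J J' : ℝ≥0 → Ω → ℝ}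

/-- `∫⁻ (a + b)² ≤ 2 ∫⁻ a² + 2 ∫⁻ b²`. [folklore] -/
private theorem lintegral_ofReal_add_sq_le {α : Type*} {mα : MeasurableSpace α} {ν : Measure α}
    {a b : α → ℝ} (ha : AEStronglyMeasurable a ν) :
    ∫⁻ x, ENNReal.ofReal ((a x + b x) ^ 2) ∂ν ≤
      2 * ∫⁻ x, ENNReal.ofReal (a x ^ 2) ∂ν + 2 * ∫⁻ x, ENNReal.ofReal (b x ^ 2) ∂ν := by
  have hm : AEMeasurable (fun x ↦ 2 * ENNReal.ofReal (a x ^ 2)) ν :=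
    ((ha.aemeasurable.pow_const 2).ennreal_ofReal).const_mul 2
  rw [← lintegral_const_mul'' _ (ha.aemeasurable.pow_const 2).ennreal_ofReal,
    ← lintegral_const_mul' _ _ ENNReal.ofNat_ne_top, ← lintegral_add_left' hm]
  refine lintegral_mono fun x ↦ ?_
  have hle : (a x + b x) ^ 2 ≤ 2 * a x ^ 2 + 2 * b x ^ 2 := by nlinarith [sq_nonneg (a x - b x)]
  calc ENNReal.ofReal ((a x + b x) ^ 2) ≤ ENNReal.ofReal (2 * a x ^ 2 + 2 * b x ^ 2) :=
      ENNReal.ofReal_le_ofReal hle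
    _ = 2 * ENNReal.ofReal (a x ^ 2) + 2 * ENNReal.ofReal (b x ^ 2) := by
      rw [ENNReal.ofReal_add (by positivity) (by positivity), ENNReal.ofReal_mul zero_le_two,
        ENNReal.ofReal_mul zero_le_two, ENNReal.ofReal_ofNat]

/-- `L²` convergence of increments from `L²` convergence at the two times. [folklore] -/
private theorem tendsto_lintegral_incr_sq {X : ℕ → ℝ≥0 → Ω → ℝ} {Y : ℝ≥0 → Ω → ℝ}
    (hXm : ∀ n r, AEStronglyMeasurable (X n r) μ) (hYm : ∀ r, AEStronglyMeasurable (Y r) μ)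
    {s t : ℝ≥0}
    (hs : Tendsto (fun n ↦ ∫⁻ ω, ENNReal.ofReal ((X n s ω - Y s ω) ^ 2) ∂μ) atTop (𝓝 0))
    (ht : Tendsto (fun n ↦ ∫⁻ ω, ENNReal.ofReal ((X n t ω - Y t ω) ^ 2) ∂μ) atTop (𝓝 0)) :
    Tendsto (fun n ↦ ∫⁻ ω, ENNReal.ofReal (((X n t ω - X n s ω) - (Y t ω - Y s ω)) ^ 2) ∂μ)
      atTop (𝓝 0) := by
  have hle : ∀ n, ∫⁻ ω, ENNReal.ofReal (((X n t ω - X n s ω) - (Y t ω - Y s ω)) ^ 2) ∂μ ≤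
      2 * ∫⁻ ω, ENNReal.ofReal ((X n t ω - Y t ω) ^ 2) ∂μ +
        2 * ∫⁻ ω, ENNReal.ofReal ((X n s ω - Y s ω) ^ 2) ∂μ := by
    intro n
    have h := lintegral_ofReal_add_sq_le (ν := μ) (a := fun ω ↦ X n t ω - Y t ω)
      (b := fun ω ↦ -(X n s ω - Y s ω)) ((hXm n t).sub (hYm t))
    simp only [neg_sq] at h
    convert h using 3 with ω
    ring
  have hlim : Tendsto (fun n ↦ 2 * ∫⁻ ω, ENNReal.ofReal ((X n t ω - Y t ω) ^ 2) ∂μ +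
      2 * ∫⁻ ω, ENNReal.ofReal ((X n s ω - Y s ω) ^ 2) ∂μ) atTop (𝓝 0) := by
    simpa using (ENNReal.Tendsto.const_mul ht (Or.inr ENNReal.ofNat_ne_top)).add
      (ENNReal.Tendsto.const_mul hs (Or.inr ENNReal.ofNat_ne_top))
  exact tendsto_of_tendsto_of_tendsto_of_le_of_le tendsto_const_nhds hlim (fun n ↦ bot_le) hle

/-- The path `r ↦ U(r⁺, ω)` of a jointly measurable process is square integrable on `[0, t]`
for a.e. `ω` when `E ∫₀ᵗ U² < ∞`. [folklore] -/
private theorem ae_memLp_two_path {U : ℝ≥0 → Ω → ℝ} (hUm : Measurable fun p : Ω × ℝ ↦ U p.2.toNNReal p.1)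
    {t : ℝ≥0} (hfin : sqErr U 0 μ t ≠ ∞) :
    ∀ᵐ ω ∂μ, MemLp (fun r : ℝ ↦ U r.toNNReal ω) 2 (volume.restrict (Set.Icc (0 : ℝ) t)) := by
  have hmeas := measurable_lintegral_sqErr hUm (g := fun _ _ ↦ (0 : ℝ)) measurable_const t
  have hae := ae_lt_top hmeas (by simpa [sqErr] using hfin)
  filter_upwards [hae] with ω hω
  simp only [sub_zero] at hω
  exact memLp_two_of_lintegral_sq_ne_top
    ((hUm.comp measurable_prodMk_left).aestronglyMeasurable) hω.ne

/-- **Covariation of two Itô integrals (conditional polarised isometry).**  Let `B, B'` be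
continuous square-integrable `𝓕`-martingales with `B_t² - t`, `B'_t² - t` and
`B_t B'_t - c t` martingales, `H, K` progressive with `E ∫₀ᵗ H² < ∞`, `E ∫₀ᵗ K² < ∞`, and
`J = ∫ H dB`, `J' = ∫ K dB'` their Itô integrals (`IsItoIntegral`).  Then for `s ≤ t` and every
bounded `𝓕_s`-measurable `Z`,
`E[Z (J_t - J_s)(J'_t - J'_s)] = c · E[Z ∫_{(s,t]} H_r K_r dr]`,
i.e. `J J' - c ∫₀ H K dr` has orthogonal increments (`⟨J, J'⟩ = c ∫₀ H K dr`).  For `B' = B`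
(`c = 1`) this is the conditional Itô isometry; for orthogonal `B, B'` (`c = 0`) Itô integrals
against them are orthogonal — the zero cross-variation of different Brownian coordinates.
Revuz–Yor, *Continuous Martingales and Brownian Motion* (1999), Ch. IV, Thm (2.2)
(`⟨K·M, N⟩ = K·⟨M, N⟩`); Le Gall (2016), Thm 5.4, eq. (5.6).
[cite: RevuzYor1999, Ch. IV Thm (2.2)] -/
theorem IsItoIntegral.integral_mul_sub_mul_sub [IsProbabilityMeasure μ]
    (hB : Martingale B 𝓕 μ) (hBsq : Martingale (fun t ω ↦ B t ω ^ 2 - (t : ℝ)) 𝓕 μ)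
    (hB2 : ∀ t, MemLp (B t) 2 μ) (hBc : ∀ ω, Continuous (B · ω))
    (hB' : Martingale B' 𝓕 μ) (hB'sq : Martingale (fun t ω ↦ B' t ω ^ 2 - (t : ℝ)) 𝓕 μ)
    (hB'2 : ∀ t, MemLp (B' t) 2 μ) (hB'c : ∀ ω, Continuous (B' · ω))
    (hcov : Martingale (fun t ω ↦ B t ω * B' t ω - c * (t : ℝ)) 𝓕 μ)
    (hH : IsStronglyProgressive 𝓕 H) (hK : IsStronglyProgressive 𝓕 K)
    (hHfin : ∀ t : ℝ≥0, sqErr H 0 μ t ≠ ∞) (hKfin : ∀ t : ℝ≥0, sqErr K 0 μ t ≠ ∞)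
    (hJ : IsItoIntegral H B J 𝓕 μ) (hJ' : IsItoIntegral K B' J' 𝓕 μ)
    {s t : ℝ≥0} (hst : s ≤ t) {Z : Ω → ℝ} (hZ : StronglyMeasurable[𝓕 s] Z) {C : ℝ}
    (hC : ∀ ω, |Z ω| ≤ C) :
    ∫ ω, Z ω * ((J t ω - J s ω) * (J' t ω - J' s ω)) ∂μ =
      c * ∫ ω, Z ω * (∫ r in Set.Ioc (s : ℝ) t, H r.toNNReal ω * K r.toNNReal ω) ∂μ := by
  have hHm := measurable_toNNReal_of_isStronglyProgressive hH
  have hKm := measurable_toNNReal_of_isStronglyProgressive hK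
  have hZm : AEStronglyMeasurable Z μ := (hZ.mono (𝓕.le s)).aestronglyMeasurable
  have hZb : ∀ᵐ ω ∂μ, ‖Z ω‖ ≤ C := ae_of_all _ fun ω ↦ by simpa [Real.norm_eq_abs] using hC ω
  -- the constructed versions and their approximating sequences
  obtain ⟨I, hI, hIM, hI2, Hn, hHnE, hHnL⟩ := exists_isItoIntegral_of_sqErr_ne_top hB hBsq hB2 hBc hH hHfin
  obtain ⟨I', hI', hI'M, hI'2, Kn, hKnE, hKnL⟩ :=
    exists_isItoIntegral_of_sqErr_ne_top hB' hB'sq hB'2 hB'c hK hKfin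
  have hJI : ∀ᵐ ω ∂μ, ∀ r, J r ω = I r ω := IsItoIntegral.unique_holds hJ hI
  have hJI' : ∀ᵐ ω ∂μ, ∀ r, J' r ω = I' r ω := IsItoIntegral.unique_holds hJ' hI'
  -- replace `J, J'` by `I, I'`
  have hlhs : ∫ ω, Z ω * ((J t ω - J s ω) * (J' t ω - J' s ω)) ∂μ =
      ∫ ω, Z ω * ((I t ω - I s ω) * (I' t ω - I' s ω)) ∂μ := by
    refine integral_congr_ae ?_
    filter_upwards [hJI, hJI'] with ω h1 h2
    rw [h1 t, h1 s, h2 t, h2 s]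
  rw [hlhs]
  -- the identity along the approximating sequences
  have hn : ∀ n, ∫ ω, Z ω * ((((Hn n).integral B t ω - (Hn n).integral B s ω)) *
      ((Kn n).integral B' t ω - (Kn n).integral B' s ω)) ∂μ =
      c * ∫ ω, Z ω * (∫ r in Set.Ioc (s : ℝ) t,
        (Hn n).toProcess r.toNNReal ω * (Kn n).toProcess r.toNNReal ω) ∂μ :=
    fun n ↦ (Hn n).integral_mul_sub_mul_sub (Kn n) hB hB' hB2 hB'2 hcov hst hZ hC
  -- LHS convergence: products of `L²`-convergent increments
  have hL : Tendsto (fun n ↦ ∫ ω, Z ω * ((((Hn n).integral B t ω - (Hn n).integral B s ω)) *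
      ((Kn n).integral B' t ω - (Kn n).integral B' s ω)) ∂μ) atTop
      (𝓝 (∫ ω, Z ω * ((I t ω - I s ω) * (I' t ω - I' s ω)) ∂μ)) := by
    have hXm : ∀ n r, AEStronglyMeasurable ((Hn n).integral B r) μ := fun n r ↦
      (((Hn n).stronglyMeasurable_integral hB.stronglyAdapted r).mono (𝓕.le r)).aestronglyMeasurable
    have hYm : ∀ n r, AEStronglyMeasurable ((Kn n).integral B' r) μ := fun n r ↦
      (((Kn n).stronglyMeasurable_integral hB'.stronglyAdapted r).mono (𝓕.le r)).aestronglyMeasurable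
    refine tendsto_integral_mul_mul_of_lintegral_sq hZm hC ((hI2 t).sub (hI2 s)) ((hI'2 t).sub (hI'2 s))
      (fun n ↦ ((Hn n).memLp_integral hB2 t).sub ((Hn n).memLp_integral hB2 s))
      (fun n ↦ ((Kn n).memLp_integral hB'2 t).sub ((Kn n).memLp_integral hB'2 s)) ?_ ?_
    · exact tendsto_lintegral_incr_sq hXm (fun r ↦ (hI2 r).1) (hHnL s) (hHnL t)
    · exact tendsto_lintegral_incr_sq hYm (fun r ↦ (hI'2 r).1) (hKnL s) (hKnL t)
  -- RHS convergence: time integrals of products, via `L²(dr ⊗ μ)`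
  have hR : Tendsto (fun n ↦ c * ∫ ω, Z ω * (∫ r in Set.Ioc (s : ℝ) t,
        (Hn n).toProcess r.toNNReal ω * (Kn n).toProcess r.toNNReal ω) ∂μ) atTop
      (𝓝 (c * ∫ ω, Z ω * (∫ r in Set.Ioc (s : ℝ) t, H r.toNNReal ω * K r.toNNReal ω) ∂μ)) := by
    refine Tendsto.const_mul c ?_
    -- product space
    set ν : Measure (Ω × ℝ) := μ.prod (volume.restrict (Set.Icc (0 : ℝ) t)) with hν
    have hHν : AEStronglyMeasurable (fun p : Ω × ℝ ↦ H p.2.toNNReal p.1) ν := hHm.aestronglyMeasurable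
    have hKν : AEStronglyMeasurable (fun p : Ω × ℝ ↦ K p.2.toNNReal p.1) ν := hKm.aestronglyMeasurable
    have hHnν : ∀ n, AEStronglyMeasurable (fun p : Ω × ℝ ↦ (Hn n).toProcess p.2.toNNReal p.1) ν :=
      fun n ↦ (Hn n).measurable_toProcess_prod.aestronglyMeasurable
    have hKnν : ∀ n, AEStronglyMeasurable (fun p : Ω × ℝ ↦ (Kn n).toProcess p.2.toNNReal p.1) ν :=
      fun n ↦ (Kn n).measurable_toProcess_prod.aestronglyMeasurable
    have hH2ν : ∫⁻ p, ENNReal.ofReal ((H p.2.toNNReal p.1) ^ 2) ∂ν ≠ ∞ := by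
      have := sqErr_eq_lintegral_prod (μ := μ) hHm (g := fun _ _ ↦ (0 : ℝ)) measurable_const t
      simp only [sub_zero] at this
      rw [← this]; exact hHfin t
    have hK2ν : ∫⁻ p, ENNReal.ofReal ((K p.2.toNNReal p.1) ^ 2) ∂ν ≠ ∞ := by
      have := sqErr_eq_lintegral_prod (μ := μ) hKm (g := fun _ _ ↦ (0 : ℝ)) measurable_const t
      simp only [sub_zero] at this
      rw [← this]; exact hKfin t
    have hHl : Tendsto (fun n ↦ ∫⁻ p, ENNReal.ofReal
        (((Hn n).toProcess p.2.toNNReal p.1 - H p.2.toNNReal p.1) ^ 2) ∂ν) atTop (𝓝 0) := by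
      refine (tendsto_congr fun n ↦ ?_).1 (hHnE t)
      rw [(Hn n).approxErr_eq_sqErr, sqErr_eq_lintegral_prod (Hn n).measurable_toProcess_prod hHm]
    have hKl : Tendsto (fun n ↦ ∫⁻ p, ENNReal.ofReal
        (((Kn n).toProcess p.2.toNNReal p.1 - K p.2.toNNReal p.1) ^ 2) ∂ν) atTop (𝓝 0) := by
      refine (tendsto_congr fun n ↦ ?_).1 (hKnE t)
      rw [(Kn n).approxErr_eq_sqErr, sqErr_eq_lintegral_prod (Kn n).measurable_toProcess_prod hKm]
    have hprod := tendsto_lintegral_enorm_mul_sub_mul hHν hKν hHnν hKnν hH2ν hK2ν hHl hKl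
    -- the time integrals
    set R : Ω → ℝ := fun ω ↦ ∫ r in Set.Ioc (s : ℝ) t, H r.toNNReal ω * K r.toNNReal ω with hRdef
    set Rn : ℕ → Ω → ℝ := fun n ω ↦ ∫ r in Set.Ioc (s : ℝ) t,
      (Hn n).toProcess r.toNNReal ω * (Kn n).toProcess r.toNNReal ω with hRndef
    have hsub : Set.Ioc (s : ℝ) t ⊆ Set.Icc (0 : ℝ) t := fun r hr ↦ ⟨s.2.trans hr.1.le, hr.2⟩
    -- a.e. integrability of the limit integrand along paths
    have hint : ∀ᵐ ω ∂μ, IntegrableOn (fun r : ℝ ↦ H r.toNNReal ω * K r.toNNReal ω)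
        (Set.Ioc (s : ℝ) t) volume := by
      filter_upwards [ae_memLp_two_path hHm (hHfin t), ae_memLp_two_path hKm (hKfin t)] with ω h1 h2
      have h12 : IntegrableOn (fun r : ℝ ↦ H r.toNNReal ω * K r.toNNReal ω) (Set.Icc (0 : ℝ) t)
          volume := h1.integrable_mul h2
      exact h12.mono_set hsub
    have hintn : ∀ n ω, IntegrableOn (fun r : ℝ ↦ (Hn n).toProcess r.toNNReal ω *
        (Kn n).toProcess r.toNNReal ω) (Set.Ioc (s : ℝ) t) volume := by
      intro n ω
      obtain ⟨CH, hCH⟩ := (Hn n).bounded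
      obtain ⟨CK, hCK⟩ := (Kn n).bounded
      have hm : AEStronglyMeasurable (fun r : ℝ ↦ (Hn n).toProcess r.toNNReal ω *
          (Kn n).toProcess r.toNNReal ω) (volume.restrict (Set.Ioc (s : ℝ) t)) :=
        (((Hn n).measurable_toProcess_prod.comp measurable_prodMk_left).mul
          ((Kn n).measurable_toProcess_prod.comp measurable_prodMk_left)).aestronglyMeasurable
      refine ⟨hm, HasFiniteIntegral.of_bounded (μ := volume.restrict (Set.Ioc (s : ℝ) t))
        (C := max CH 0 * max CK 0) (ae_of_all _ fun r ↦ ?_)⟩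
      rw [norm_mul, Real.norm_eq_abs, Real.norm_eq_abs]
      exact mul_le_mul ((Hn n).abs_toProcess_le hCH _ ω) ((Kn n).abs_toProcess_le hCK _ ω)
        (abs_nonneg _) (le_max_right _ _)
    -- measurability / integrability of `R`, `Rn` in `ω`
    have hRnm : ∀ n, AEStronglyMeasurable (Rn n) μ := fun n ↦ by
      have h := ((Hn n).measurable_toProcess_prod.mul (Kn n).measurable_toProcess_prod).stronglyMeasurable
      exact (h.integral_prod_right' (ν := volume.restrict (Set.Ioc (s : ℝ) t))).aestronglyMeasurable
    have hRm : AEStronglyMeasurable R μ := by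
      have h := (hHm.mul hKm).stronglyMeasurable
      exact (h.integral_prod_right' (ν := volume.restrict (Set.Ioc (s : ℝ) t))).aestronglyMeasurable
    -- pathwise bound `‖Rₙ - R‖ₑ ≤ ∫⁻_{[0,t]} ‖HₙKₙ - HK‖ₑ`
    have hpath : ∀ᵐ ω ∂μ, ∀ n, ‖Rn n ω - R ω‖ₑ ≤ ∫⁻ r in Set.Icc (0 : ℝ) t,
        ‖(Hn n).toProcess r.toNNReal ω * (Kn n).toProcess r.toNNReal ω -
          H r.toNNReal ω * K r.toNNReal ω‖ₑ := by
      filter_upwards [hint] with ω hω n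
      rw [hRndef, hRdef]
      simp only
      rw [← integral_sub (hintn n ω) hω]
      exact (enorm_integral_le_lintegral_enorm _).trans (lintegral_mono_set hsub)
    -- `L¹(μ)` convergence of `Z Rₙ → Z R`
    have hle : ∀ n, ∫⁻ ω, ‖Z ω * Rn n ω - Z ω * R ω‖ₑ ∂μ ≤ ENNReal.ofReal C *
        ∫⁻ p, ‖(Hn n).toProcess p.2.toNNReal p.1 * (Kn n).toProcess p.2.toNNReal p.1 -
          H p.2.toNNReal p.1 * K p.2.toNNReal p.1‖ₑ ∂ν := by
      intro n
      have hmeas : AEMeasurable (fun p : Ω × ℝ ↦ ‖(Hn n).toProcess p.2.toNNReal p.1 *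
          (Kn n).toProcess p.2.toNNReal p.1 - H p.2.toNNReal p.1 * K p.2.toNNReal p.1‖ₑ) ν :=
        (((hHnν n).mul (hKnν n)).sub (hHν.mul hKν)).aemeasurable.enorm
      rw [hν, lintegral_prod _ (by rw [← hν]; exact hmeas), ← lintegral_const_mul' _ _ ENNReal.ofReal_ne_top]
      refine lintegral_mono_ae ?_
      filter_upwards [hpath] with ω hω
      rw [← mul_sub, enorm_mul]
      gcongr
      · rw [Real.enorm_eq_ofReal_abs]; exact ENNReal.ofReal_le_ofReal (hC ω)
      · exact hω n
    have hlim : Tendsto (fun n ↦ ENNReal.ofReal C *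
        ∫⁻ p, ‖(Hn n).toProcess p.2.toNNReal p.1 * (Kn n).toProcess p.2.toNNReal p.1 -
          H p.2.toNNReal p.1 * K p.2.toNNReal p.1‖ₑ ∂ν) atTop (𝓝 0) := by
      simpa using ENNReal.Tendsto.const_mul hprod (Or.inr ENNReal.ofReal_ne_top)
    have hL1 : Tendsto (fun n ↦ ∫⁻ ω, ‖Z ω * Rn n ω - Z ω * R ω‖ₑ ∂μ) atTop (𝓝 0) :=
      tendsto_of_tendsto_of_tendsto_of_le_of_le tendsto_const_nhds hlim (fun n ↦ bot_le) hle
    -- integrability of `Z Rₙ`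
    have hRnI : ∀ n, Integrable (fun ω ↦ Z ω * Rn n ω) μ := by
      intro n
      obtain ⟨CH, hCH⟩ := (Hn n).bounded
      obtain ⟨CK, hCK⟩ := (Kn n).bounded
      have hRnb : ∀ ω, ‖Rn n ω‖ ≤ max CH 0 * max CK 0 * ((t : ℝ) - s) := by
        intro ω
        rw [hRndef]
        have := norm_setIntegral_le_of_norm_le_const (μ := volume) (s := Set.Ioc (s : ℝ) t)
          (f := fun r : ℝ ↦ (Hn n).toProcess r.toNNReal ω * (Kn n).toProcess r.toNNReal ω)
          (C := max CH 0 * max CK 0) (by rw [Real.volume_Ioc]; exact ENNReal.ofReal_lt_top)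
          (fun r _ ↦ by
            rw [norm_mul, Real.norm_eq_abs, Real.norm_eq_abs]
            exact mul_le_mul ((Hn n).abs_toProcess_le hCH _ ω) ((Kn n).abs_toProcess_le hCK _ ω)
              (abs_nonneg _) (le_max_right _ _))
        rwa [Real.volume_real_Ioc_of_le (NNReal.coe_le_coe.2 hst)] at this
      exact ((integrable_const _).mono' (hRnm n) (ae_of_all _ hRnb)).bdd_mul hZm hZb
    exact tendsto_integral_of_L1 (fun ω ↦ Z ω * R ω) (hZm.mul hRm) (Eventually.of_forall hRnI) hL1
  -- conclude
  exact tendsto_nhds_unique ((tendsto_congr hn).1 hL) hR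

/-! ### Consequences: versions, orthogonal increments, the conditional isometry -/

/-- An Itô integral of a square-integrable progressive integrand is, at each time, a.e. equal to
the square-integrable martingale version of the construction; in particular `J_t ∈ L²`.
[cite: RevuzYor1999, Ch. IV Thm (2.2) (`K·M ∈ H²`)] -/
theorem IsItoIntegral.memLp_two [IsProbabilityMeasure μ]
    (hB : Martingale B 𝓕 μ) (hBsq : Martingale (fun t ω ↦ B t ω ^ 2 - (t : ℝ)) 𝓕 μ)
    (hB2 : ∀ t, MemLp (B t) 2 μ) (hBc : ∀ ω, Continuous (B · ω))
    (hH : IsStronglyProgressive 𝓕 H) (hHfin : ∀ t : ℝ≥0, sqErr H 0 μ t ≠ ∞)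
    (hJ : IsItoIntegral H B J 𝓕 μ) (t : ℝ≥0) : MemLp (J t) 2 μ := by
  obtain ⟨I, hI, -, hI2, -⟩ := exists_isItoIntegral_of_sqErr_ne_top hB hBsq hB2 hBc hH hHfin
  have hJI : ∀ᵐ ω ∂μ, ∀ r, J r ω = I r ω := IsItoIntegral.unique_holds hJ hI
  exact (hI2 t).ae_eq (hJI.mono fun ω hω ↦ (hω t).symm)

/-- **Increments of Itô integrals are orthogonal to `L²(𝓕_s)`**: `E[G (J_t - J_s)] = 0` for
`G ∈ L²` strongly `𝓕_s`-measurable (`J` is a version of a square-integrable martingale).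
[cite: RevuzYor1999, Ch. IV Thm (2.2) (`K·M ∈ H²₀` is a martingale)] -/
theorem IsItoIntegral.integral_mul_sub_eq_zero [IsProbabilityMeasure μ]
    (hB : Martingale B 𝓕 μ) (hBsq : Martingale (fun t ω ↦ B t ω ^ 2 - (t : ℝ)) 𝓕 μ)
    (hB2 : ∀ t, MemLp (B t) 2 μ) (hBc : ∀ ω, Continuous (B · ω))
    (hH : IsStronglyProgressive 𝓕 H) (hHfin : ∀ t : ℝ≥0, sqErr H 0 μ t ≠ ∞)
    (hJ : IsItoIntegral H B J 𝓕 μ) {s t : ℝ≥0} (hst : s ≤ t) {G : Ω → ℝ}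
    (hG : StronglyMeasurable[𝓕 s] G) (hG2 : MemLp G 2 μ) :
    ∫ ω, G ω * (J t ω - J s ω) ∂μ = 0 := by
  obtain ⟨I, hI, hIM, hI2, -⟩ := exists_isItoIntegral_of_sqErr_ne_top hB hBsq hB2 hBc hH hHfin
  have hJI : ∀ᵐ ω ∂μ, ∀ r, J r ω = I r ω := IsItoIntegral.unique_holds hJ hI
  have heq : ∫ ω, G ω * (J t ω - J s ω) ∂μ = ∫ ω, G ω * (I t ω - I s ω) ∂μ := by
    refine integral_congr_ae ?_
    filter_upwards [hJI] with ω hω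
    rw [hω t, hω s]
  rw [heq]
  exact integral_mul_sub_eq_zero_of_martingale_of_memLp hIM hI2 hst hG hG2

/-- **Conditional Itô isometry** (the case `B' = B`, `c = 1`):
`E[Z (J_t - J_s)(J'_t - J'_s)] = E[Z ∫_{(s,t]} H_r K_r dr]` for two Itô integrals against the same
`B`. [cite: RevuzYor1999, Ch. IV Thm (2.2) (isometry `‖K·M‖_{H²} = ‖K‖_{L²(M)}`)] -/
theorem IsItoIntegral.integral_mul_sub_mul_sub_self [IsProbabilityMeasure μ]
    (hB : Martingale B 𝓕 μ) (hBsq : Martingale (fun t ω ↦ B t ω ^ 2 - (t : ℝ)) 𝓕 μ)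
    (hB2 : ∀ t, MemLp (B t) 2 μ) (hBc : ∀ ω, Continuous (B · ω))
    (hH : IsStronglyProgressive 𝓕 H) (hK : IsStronglyProgressive 𝓕 K)
    (hHfin : ∀ t : ℝ≥0, sqErr H 0 μ t ≠ ∞) (hKfin : ∀ t : ℝ≥0, sqErr K 0 μ t ≠ ∞)
    (hJ : IsItoIntegral H B J 𝓕 μ) (hJ' : IsItoIntegral K B J' 𝓕 μ)
    {s t : ℝ≥0} (hst : s ≤ t) {Z : Ω → ℝ} (hZ : StronglyMeasurable[𝓕 s] Z) {C : ℝ}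
    (hC : ∀ ω, |Z ω| ≤ C) :
    ∫ ω, Z ω * ((J t ω - J s ω) * (J' t ω - J' s ω)) ∂μ =
      ∫ ω, Z ω * (∫ r in Set.Ioc (s : ℝ) t, H r.toNNReal ω * K r.toNNReal ω) ∂μ := by
  have hcov : Martingale (fun t ω ↦ B t ω * B t ω - 1 * (t : ℝ)) 𝓕 μ := by
    have heq : (fun t ω ↦ B t ω * B t ω - 1 * (t : ℝ)) = fun t ω ↦ B t ω ^ 2 - (t : ℝ) := by
      funext t ω; ring
    rw [heq]; exact hBsq
  have h := IsItoIntegral.integral_mul_sub_mul_sub hB hBsq hB2 hBc hB hBsq hB2 hBc hcov hH hK hHfin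
    hKfin hJ hJ' hst hZ hC
  simpa using h

/-- **Second moment of the increments**: `E[(J_t - J_s)²] = E ∫_{(s,t]} H_r² dr`.
[cite: RevuzYor1999, Ch. IV Thm (2.2) (isometry)] -/
theorem IsItoIntegral.integral_sub_sq [IsProbabilityMeasure μ]
    (hB : Martingale B 𝓕 μ) (hBsq : Martingale (fun t ω ↦ B t ω ^ 2 - (t : ℝ)) 𝓕 μ)
    (hB2 : ∀ t, MemLp (B t) 2 μ) (hBc : ∀ ω, Continuous (B · ω))
    (hH : IsStronglyProgressive 𝓕 H) (hHfin : ∀ t : ℝ≥0, sqErr H 0 μ t ≠ ∞)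
    (hJ : IsItoIntegral H B J 𝓕 μ) {s t : ℝ≥0} (hst : s ≤ t) :
    ∫ ω, (J t ω - J s ω) ^ 2 ∂μ = ∫ ω, (∫ r in Set.Ioc (s : ℝ) t, H r.toNNReal ω ^ 2) ∂μ := by
  have h := IsItoIntegral.integral_mul_sub_mul_sub_self hB hBsq hB2 hBc hH hH hHfin hHfin hJ hJ hst
    (Z := fun _ ↦ (1 : ℝ)) stronglyMeasurable_const (C := 1) (fun _ ↦ by simp)
  simp only [one_mul] at h
  simpa only [sq] using h

/-- An Itô integral of a square-integrable progressive integrand is a.e. strongly measurable at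
each time (it is a.e. equal to the strongly adapted version of the construction).
[cite: RevuzYor1999, Ch. IV Thm (2.2) (`K·M ∈ H²`)] -/
theorem IsItoIntegral.aestronglyMeasurable [IsProbabilityMeasure μ]
    (hB : Martingale B 𝓕 μ) (hBsq : Martingale (fun t ω ↦ B t ω ^ 2 - (t : ℝ)) 𝓕 μ)
    (hB2 : ∀ t, MemLp (B t) 2 μ) (hBc : ∀ ω, Continuous (B · ω))
    (hH : IsStronglyProgressive 𝓕 H) (hHfin : ∀ t : ℝ≥0, sqErr H 0 μ t ≠ ∞)
    (hJ : IsItoIntegral H B J 𝓕 μ) (t : ℝ≥0) : AEStronglyMeasurable (J t) μ :=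
  (IsItoIntegral.memLp_two hB hBsq hB2 hBc hH hHfin hJ t).1

/-- **Second moment bound for bounded integrands**: `E[(J_t - J_s)²] ≤ M² (t - s)` when `|H| ≤ M`.
[cite: RevuzYor1999, Ch. IV Thm (2.2) (isometry)] -/
theorem IsItoIntegral.integral_sub_sq_le [IsProbabilityMeasure μ]
    (hB : Martingale B 𝓕 μ) (hBsq : Martingale (fun t ω ↦ B t ω ^ 2 - (t : ℝ)) 𝓕 μ)
    (hB2 : ∀ t, MemLp (B t) 2 μ) (hBc : ∀ ω, Continuous (B · ω))
    (hH : IsStronglyProgressive 𝓕 H) {M : ℝ} (hM : ∀ r ω, |H r ω| ≤ M)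
    (hJ : IsItoIntegral H B J 𝓕 μ) {s t : ℝ≥0} (hst : s ≤ t) :
    ∫ ω, (J t ω - J s ω) ^ 2 ∂μ ≤ M ^ 2 * ((t : ℝ) - s) := by
  have hHm := measurable_toNNReal_of_isStronglyProgressive hH
  have hHfin : ∀ r : ℝ≥0, sqErr H 0 μ r ≠ ∞ := by
    intro r
    have hle : sqErr H 0 μ r ≤ ∫⁻ _, (∫⁻ _ in Set.Icc (0 : ℝ) r, ENNReal.ofReal (M ^ 2)) ∂μ := by
      unfold sqErr
      refine lintegral_mono fun ω ↦ lintegral_mono fun x ↦ ENNReal.ofReal_le_ofReal ?_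
      rw [Pi.zero_apply, Pi.zero_apply, sub_zero, ← sq_abs]
      exact pow_le_pow_left₀ (abs_nonneg _) (hM _ ω) 2
    have hfin : ∫⁻ _, (∫⁻ _ in Set.Icc (0 : ℝ) r, ENNReal.ofReal (M ^ 2)) ∂μ ≠ ∞ := by
      rw [lintegral_const, lintegral_const, Measure.restrict_apply_univ, Real.volume_Icc]
      exact ENNReal.mul_ne_top (ENNReal.mul_ne_top ENNReal.ofReal_ne_top ENNReal.ofReal_ne_top)
        (measure_ne_top _ _)
    exact ne_top_of_le_ne_top hfin hle
  rw [IsItoIntegral.integral_sub_sq hB hBsq hB2 hBc hH hHfin hJ hst]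
  have hle : ∀ ω, ∫ r in Set.Ioc (s : ℝ) t, H r.toNNReal ω ^ 2 ≤ M ^ 2 * ((t : ℝ) - s) := by
    intro ω
    have h := norm_setIntegral_le_of_norm_le_const (μ := volume) (s := Set.Ioc (s : ℝ) t)
      (f := fun r : ℝ ↦ H r.toNNReal ω ^ 2) (C := M ^ 2) (by rw [Real.volume_Ioc]; exact ENNReal.ofReal_lt_top)
      (fun r _ ↦ by
        rw [Real.norm_eq_abs, abs_pow]
        exact pow_le_pow_left₀ (abs_nonneg _) (hM r.toNNReal ω) 2)
    rw [Real.volume_real_Ioc_of_le (NNReal.coe_le_coe.2 hst)] at h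
    exact (Real.le_norm_self _).trans h
  calc ∫ ω, (∫ r in Set.Ioc (s : ℝ) t, H r.toNNReal ω ^ 2) ∂μ ≤ ∫ _, M ^ 2 * ((t : ℝ) - s) ∂μ :=
        integral_mono_of_nonneg (ae_of_all _ fun ω ↦ setIntegral_nonneg measurableSet_Ioc
          fun r _ ↦ sq_nonneg _) (integrable_const _) (ae_of_all _ hle)
    _ = M ^ 2 * ((t : ℝ) - s) := by simp

end Ito

end Literature.Probability.Process

end
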